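import Summits.BirchSwinnertonDyer.Rank1Residual.X11b.AnticyclotomicRestrictionInjective
import Literature.NumberTheory.EllipticCurves.H1CorestrictionIndexTwo
import Literature.NumberTheory.EllipticCurves.IwasawaSelmerProofs
import HarnessLib

/-!
# Class X11b, routes p2 / R1: restriction ONTO the invariants — `H¹(K, E[p^∞]) ↠ H¹(K_∞, E[p^∞])^Γ` when `E(K_∞)[p^∞] = 0` (Greenberg's Lemma 3.2 with `B = 0`, any `ℤ_p`-extension) (cell `b2b-bsdres`, sub-cell `multr1-p2`, gen 12)

HONEST FRAMING (verbatim, cell `b2b-bsdres`): the goal of the cell is to DELETE the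
COMBINATION-SHAPED residual classes for ALL analytic-rank `≤ 1` curves over `ℚ` — "full BSD
formula for every rank `≤ 1` curve in class `C`" assembled STRICTLY from published theorems — so
that the rank-`≤ 1` remainder becomes exactly the CONSTRUCTION-SHAPED classes, which are TYPED
(missing-input Props), NOT attempted; this is not "finishing BSD". Research route `p2` for class
X11b; no claim beyond the stated class; nothing booked; X11b stays CONSTRUCTION-SHAPED. THEOREMS
ONLY (no definition, no named fact, no `sorry`). Companion of the sibling sub-cell's
`AnticyclotomicRestrictionInjective.lean` (multr1-p1: the kernel of the restriction is trivial).

## Content — the first provable piece of route p2's algebraic input (REPORT §18.5)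

Route p2's control input (`ControlUpperOnTreeAt`, `BDPRouteControlUpper.lean`) is an UPPER bound on
`#H⁰(Γ, Sel_𝔭(K_∞, E[p^∞]))`; in Greenberg's control argument (LNM 1716 §3; JSW17 §3.3) this is the
direction `#Sel(K_∞)^Γ ≤ #Sel(K) · #coker(h) · ∏_v #ker(r_v)` of the snake lemma, whose first
ingredient is **Lemma 3.2, `coker(h) = 0`**: the restriction `h : H¹(K, E[p^∞]) → H¹(K_∞, E[p^∞])^Γ`
is ONTO the invariants. Greenberg proves it from `H²(Γ, B) = 0` (`cd_p ℤ_p = 1`). CORRECTION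
(gen 12, after landing): the tree ALREADY PROVES Lemma 3.2 in full — for every discrete `p`-primary
`Γ_K`-module and EVERY `ℤ_p`-extension, with no hypothesis on `B` —
`Literature.NumberTheory.EllipticCurves.ZpExtension.mem_range_resOfLe_of_conjH1_eq` and the discharge
`WeierstrassCurve.Greenberg1999_layerInvariants_le_range_holds` (`IwasawaSelmerControlCokerProofs.lean`,
the cocycle-level `cd_p(ℤ_p) = 1` argument), already used by the sibling sub-cell's
`AnticyclotomicControlCokernel.lean`; the elliptic-curve corollaries below are therefore NOT new
capability (they follow from that theorem in a few lines, without `B = 0`). What this file adds is a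
second, shorter proof under `B = E(K_∞)[p^∞] = 0` — a THEOREM on X11b's data (multr1-p1,
`fixedPoints_kerSubgroup_eq_bot_of_irr_of_ram`) — valid for an ARBITRARY profinite `G ⊵ N` and
intermediate group `N ≤ G₀ ≤ G` (not only the layers of a `ℤ_p`-extension) and for modules with
`M^N = 0` rather than `p`-primary ones:

* `exists_openNormalSubgroup_conjCocycle_eq` — a continuous cocycle on a compact normal subgroup
  `N` of a profinite `G` is FIXED ON THE NOSE by conjugation by an open normal subgroup of `G`
  (finitely many values, each with open stabiliser; zero near `1`).
* **`exists_resOfLe_eq_of_forall_conjH1_eq`** — generic inflation–restriction surjectivity: for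
  `G` profinite, `N ⊴ G` compact, `M` a discrete `G`-module with continuous orbit maps and
  `M^N = 0`, and `N ≤ G₀ ≤ G`: every class of `H¹(N, M)` fixed by `conj_σ` for all `σ ∈ G₀` is the
  restriction of a class of `H¹(G₀, M)`. Proof: for a representing cocycle `φ` and `σ ∈ G₀`,
  `σ·φ − φ = ∂v_σ` with `v_σ` UNIQUE (`M^N = 0`); `σ ↦ v_σ` is a crossed homomorphism on `G₀`
  extending `φ`, continuous because `v_σ = 0` on the open stabiliser of `φ`.
* `layerInvariants_le_range_of_fixedPoints_eq_bot` — for an elliptic `E/K` (number field), ANY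
  `ℤ_p`-extension `κ` and every layer `n`: `E(K_∞)[p^∞] = 0 ⟹ H¹(K_∞, E[p^∞])^{Γ_n} ⊆ im h_n`
  (`W.layerInvariants κ n ≤ (W.layerToInfty κ n).range`) — a special case (`B = 0`) of the tree's
  `Greenberg1999_layerInvariants_le_range_holds` / `ZpExtension.mem_range_resOfLe_of_conjH1_eq`
  (which need no hypothesis on `B`), re-derived from the generic theorem above.
* `layerInvariants_le_range_of_irr_of_ram` — on X11b's data: `E/ℚ` with `E[p]` irreducible and a
  (ram) prime, `p ≠ 2`, `K` quadratic, `κ` ANY `ℤ_p`-extension (in particular the anticyclotomic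
  one): `h_n` is onto the invariants for every `n`; with multr1-p1's injectivity
  (`resSubgroup_kerSubgroup_injective_of_irr_of_ram`) the restriction is an ISOMORPHISM
  `H¹(K_n, E[p^∞]) ≅ H¹(K_∞, E[p^∞])^{Γ_n}` (both halves also obtainable from the tree's general
  Lemmas 3.1/3.2; the sibling's `AnticyclotomicControlMap.lean` / `AnticyclotomicControlCokernel.lean`
  carry the control map `s` itself on Castella's Selmer groups).

Nothing booked; labels unchanged; a lemma toward (T1ᵗ-CTL≤), not a discharge of it, and — for the
elliptic-curve statements — not new capability (see the CORRECTION above).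

References: [GreenbergLNM1716] §3 Lemmas 3.1–3.2 (p. 86); [SerreGaloisCohomology1997] I.§2.6
(inflation–restriction), I.§5.8; [NeukirchSchmidtWingberg2008] (1.6.7); [JetchevSkinnerWan2017]
§3.3.2–3.3.4 (the maps `h`, `g`); [Castella2018Erratum] Lemma 2.1.
-/

noncomputable section

open scoped Classical

universe u

namespace Summit.BirchSwinnertonDyer.Rank1Residual.X11b

open Literature.NumberTheory.EllipticCurves Literature.NumberTheory.GaloisRepresentations
  Literature.NumberTheory.EllipticCurves.Rank1Residual

/-! ### Generic: a cocycle on a compact normal subgroup is fixed by an open normal subgroup -/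

section Generic

variable {G : Type u} [Group G] [TopologicalSpace G] [IsTopologicalGroup G]
  [CompactSpace G] [TotallyDisconnectedSpace G]
variable (N : Subgroup G) [N.Normal] [CompactSpace N]
variable {M : Type u} [AddCommGroup M] [DistribMulAction G M] [TopologicalSpace M]
  [DiscreteTopology M]

/-- **A continuous cocycle on a compact normal subgroup is fixed, as a cocycle, by conjugation by an
open normal subgroup.** For `φ : N → M` a continuous crossed homomorphism (`M` discrete with
continuous orbit maps): `φ` has finitely many values, each with an open stabiliser, and vanishes on
`N ∩ U₀` for an open `U₀ ∋ 1`; an open normal subgroup `Nrm ⊆ Stab ∩ U₀` (`G` profinite) satisfies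
`(τ·φ)(h) = τ • φ(τ⁻¹ h τ) = τ • (φ h + h • φ(h⁻¹τ⁻¹hτ)) = φ h` for `τ ∈ Nrm`. (The tree's
`WeierstrassCurve.exists_openNormalSubgroup_conjH1_eq` is the class-level statement for `E[p^∞]`;
here on the nose and generic.) [cite: NeukirchSchmidtWingberg2008, I.§5 (conjugation on cochains)]
[cite: GreenbergLNM1716, §1 p. 60] -/
theorem exists_openNormalSubgroup_conjCocycle_eq (hcont : ∀ m : M, Continuous fun g : G ↦ g • m)
    (φ : contOneCocycles (discreteTopRep N M)) :
    ∃ Nrm : OpenNormalSubgroup G, ∀ τ ∈ Nrm, conjCocycle N τ φ = φ := by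
  have hfin : (Set.range φ.1).Finite := (isCompact_range φ.1.continuous).finite_of_discrete
  set Ufix : Set G := {τ | ∀ m ∈ Set.range φ.1, τ • m = m} with hUfix_def
  have hUfix : IsOpen Ufix := by
    have e : Ufix = ⋂ m ∈ Set.range φ.1, (fun τ : G ↦ τ • m) ⁻¹' {m} := by
      ext τ
      simp only [hUfix_def, Set.mem_setOf_eq, Set.mem_iInter, Set.mem_preimage,
        Set.mem_singleton_iff]
    rw [e]
    exact hfin.isOpen_biInter fun m _ ↦ (isOpen_discrete ({m} : Set M)).preimage (hcont m)
  have hz : IsOpen {h : N | φ.1 h = 0} :=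
    (isOpen_discrete ({0} : Set M)).preimage φ.1.continuous
  obtain ⟨U0, hU0, hU0eq⟩ := isOpen_induced_iff.mp hz
  have h1fix : (1 : G) ∈ Ufix := fun m _ ↦ one_smul _ m
  have h1U0 : (1 : G) ∈ U0 := by
    have : (1 : N) ∈ Subtype.val ⁻¹' U0 := by
      rw [hU0eq]
      exact contOneCocycles.apply_one φ
    exact this
  obtain ⟨Nrm, hNrm⟩ := ProfiniteGrp.exist_openNormalSubgroup_sub_open_nhds_of_one
    (hUfix.inter hU0) ⟨h1fix, h1U0⟩
  refine ⟨Nrm, fun τ hτ ↦ ?_⟩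
  apply Subtype.ext
  ext h
  rw [conjCocycle_apply]
  have hn : ((h : G)⁻¹ * τ⁻¹ * h * τ) ∈ N := by
    have h1 : τ⁻¹ * (h : G) * τ⁻¹⁻¹ ∈ N := Subgroup.Normal.conj_mem inferInstance _ h.2 τ⁻¹
    rw [inv_inv] at h1
    have := N.mul_mem (N.inv_mem h.2) h1
    simpa only [mul_assoc] using this
  have hconj : subgroupConj N τ h = h * ⟨_, hn⟩ := Subtype.ext (by
    simp only [subgroupConj_apply_coe, Subgroup.coe_mul, mul_assoc, mul_inv_cancel_left])
  have hnN : ((h : G)⁻¹ * τ⁻¹ * h * τ) ∈ Nrm := by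
    have h1 : (h : G)⁻¹ * τ⁻¹ * (h : G)⁻¹⁻¹ ∈ Nrm.toSubgroup :=
      Subgroup.Normal.conj_mem inferInstance _ (Nrm.toSubgroup.inv_mem hτ) _
    rw [inv_inv] at h1
    exact Nrm.toSubgroup.mul_mem h1 hτ
  have hn0 : φ.1 ⟨_, hn⟩ = 0 := by
    have h0 : (⟨_, hn⟩ : N) ∈ Subtype.val ⁻¹' U0 := (hNrm hnN).2
    rw [hU0eq] at h0
    exact h0
  rw [hconj, cocycle_mul N φ h ⟨_, hn⟩, hn0, smul_zero, add_zero]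
  exact (hNrm hτ).1 _ ⟨h, rfl⟩

/-- **Inflation–restriction, surjectivity onto the invariants when `M^N = 0`.** Let `G` be a
profinite group, `N ⊴ G` compact, `M` a discrete `G`-module with continuous orbit maps and NO
non-zero `N`-fixed vector, and `N ≤ G₀ ≤ G`. Then every class `x ∈ H¹(N, M)` with `conj_σ x = x`
for all `σ ∈ G₀` is the restriction of a class of `H¹(G₀, M)`. Proof: write `x = [φ]`; for
`σ ∈ G₀`, `conj_σ [φ] = [φ]` gives `σ • φ(σ⁻¹ n σ) − φ(n) = n • v_σ − v_σ` for a `v_σ ∈ M` which is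
UNIQUE (`M^N = 0`); uniqueness forces `v_{στ} = v_σ + σ • v_τ`, `v_n = φ(n)` for `n ∈ N`, and
`v_τ = 0` on the open normal subgroup fixing `φ` (`exists_openNormalSubgroup_conjCocycle_eq`), so
`σ ↦ v_σ` is a CONTINUOUS crossed homomorphism on `G₀` restricting to `φ`. (Equivalently: the
five-term exact sequence with `H¹(G₀/N, M^N) = H²(G₀/N, M^N) = 0`.)
[cite: SerreGaloisCohomology1997, I.§2.6 (b)] [cite: NeukirchSchmidtWingberg2008, (1.6.7)]
[cite: GreenbergLNM1716, §3 Lemma 3.2 (p. 86)] -/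
theorem exists_resOfLe_eq_of_forall_conjH1_eq (hcont : ∀ m : M, Continuous fun g : G ↦ g • m)
    (hfix : ∀ m : M, (∀ n : N, (n : G) • m = m) → m = 0)
    {G₀ : Subgroup G} (hle : N ≤ G₀) (x : subgroupH1 N M)
    (hx : ∀ σ ∈ G₀, conjH1 N M σ x = x) :
    ∃ y : subgroupH1 G₀ M, resOfLe M hle y = x := by
  obtain ⟨φ, rfl⟩ := oneCocycleClass_surjective _ x
  -- for each `σ ∈ G₀`, a trivialising vector `v σ`
  have hex : ∀ σ : G₀, ∃ v : M, ∀ n : N,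
      ((σ : G) • φ.1 (subgroupConj N (σ : G) n) - φ.1 n : M) = (n : G) • v - v := by
    intro σ
    have h := hx σ σ.2
    rw [conjH1_oneCocycleClass, ← sub_eq_zero, ← oneCocycleClass_sub,
      oneCocycleClass_eq_zero_iff] at h
    obtain ⟨v, hv⟩ := h
    exact ⟨v, fun n ↦ hv n⟩
  choose v hv using hex
  -- uniqueness of the trivialising vector (`M^N = 0`)
  have huniq : ∀ {a b : M}, (∀ n : N, ((n : G) • a - a : M) = (n : G) • b - b) → a = b := by
    intro a b h
    have h0 : a - b = 0 := hfix (a - b) fun n ↦ by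
      rw [smul_sub]
      exact sub_eq_sub_iff_sub_eq_sub.mp (h n)
    exact sub_eq_zero.mp h0
  -- `v` restricts to `φ` on `N`
  have hres : ∀ n : N, v ⟨n, hle n.2⟩ = φ.1 n := by
    intro n
    apply huniq
    intro n'
    rw [← hv ⟨n, hle n.2⟩ n']
    have hconj : subgroupConj N ((⟨n, hle n.2⟩ : G₀) : G) n' = n⁻¹ * n' * n := Subtype.ext rfl
    rw [hconj, cocycle_mul N φ (n⁻¹ * n') n, cocycle_mul N φ n⁻¹ n', cocycle_inv N φ n]
    simp only [Subgroup.coe_inv, Subgroup.coe_mul, smul_add, smul_neg, smul_smul,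
      mul_inv_cancel, one_smul, mul_inv_cancel_left]
    abel
  -- `v` is a crossed homomorphism on `G₀`
  have hmul : ∀ σ τ : G₀, v (σ * τ) = v σ + (σ : G) • v τ := by
    intro σ τ
    apply huniq
    intro n
    rw [← hv (σ * τ) n]
    have e1 : (σ : G) • φ.1 (subgroupConj N (σ : G) n) = φ.1 n + ((n : G) • v σ - v σ) :=
      sub_eq_iff_eq_add'.mp (hv σ n)
    have e2 : (τ : G) • φ.1 (subgroupConj N (τ : G) (subgroupConj N (σ : G) n)) =
        φ.1 (subgroupConj N (σ : G) n) +
          (((subgroupConj N (σ : G) n : N) : G) • v τ - v τ) :=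
      sub_eq_iff_eq_add'.mp (hv τ (subgroupConj N (σ : G) n))
    have hconj : subgroupConj N ((σ * τ : G₀) : G) n =
        subgroupConj N (τ : G) (subgroupConj N (σ : G) n) := Subtype.ext (by
      simp only [Subgroup.coe_mul, subgroupConj_apply_coe, mul_inv_rev, mul_assoc])
    rw [hconj, Subgroup.coe_mul, mul_smul, e2, smul_add, smul_sub, e1, subgroupConj_apply_coe,
      smul_smul]
    have hg : (σ : G) * ((σ : G)⁻¹ * n * σ) = n * σ := by group
    rw [hg, mul_smul, smul_add]
    abel
  -- `v` vanishes on the open normal subgroup fixing `φ`, hence is continuous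
  obtain ⟨Nrm, hNrm⟩ := exists_openNormalSubgroup_conjCocycle_eq N hcont φ
  have hzero : ∀ τ : G₀, (τ : G) ∈ Nrm → v τ = 0 := by
    intro τ hτ
    apply huniq
    intro n
    rw [← hv τ n, smul_zero, sub_zero]
    have h : (τ : G) • φ.1 (subgroupConj N (τ : G) n) = φ.1 n :=
      congrArg (fun ψ : contOneCocycles (discreteTopRep N M) ↦ ψ.1 n) (hNrm τ hτ)
    rw [h, sub_self]
  have hvcont : Continuous v := by
    refine continuous_def.mpr fun S _ ↦ isOpen_iff_forall_mem_open.mpr fun σ hσ ↦ ?_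
    refine ⟨{τ : G₀ | ((σ : G)⁻¹ * τ) ∈ (Nrm : Set G)}, ?_, ?_, ?_⟩
    · intro τ hτ
      have hmem : ((σ⁻¹ * τ : G₀) : G) ∈ Nrm := hτ
      have hτσ : v τ = v σ := by
        have h := hmul σ (σ⁻¹ * τ)
        rw [mul_inv_cancel_left, hzero _ hmem, smul_zero, add_zero] at h
        exact h
      show τ ∈ v ⁻¹' S
      rw [Set.mem_preimage, hτσ]
      exact hσ
    · exact Nrm.isOpen'.preimage (continuous_const.mul continuous_subtype_val)
    · show ((σ : G)⁻¹ * σ) ∈ (Nrm : Set G)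
      rw [inv_mul_cancel]
      exact Nrm.toSubgroup.one_mem
  -- the lift
  let Φ : contOneCocycles (discreteTopRep G₀ M) := ⟨⟨v, hvcont⟩, fun σ τ ↦ hmul σ τ⟩
  refine ⟨oneCocycleClass _ Φ, ?_⟩
  have hmap : resOfLe M hle (oneCocycleClass _ Φ) =
      oneCocycleClass _ (contOneCocycles.pullback (subgroupInclusion hle)
        (resHomOfEquivariant (subgroupInclusion hle) (AddMonoidHom.id M) fun _ _ ↦ rfl) Φ) :=
    map_oneCocycleClass _ _ _ Φ
  rw [hmap]
  congr 1
  apply Subtype.ext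
  ext n
  rw [contOneCocycles.pullback_apply]
  exact hres n

end Generic

/-! ### Elliptic curves: Greenberg's Lemma 3.2 with `B = 0`, ANY `ℤ_p`-extension -/

section Elliptic

variable {K : Type u} [Field K] [NumberField K] (W : WeierstrassCurve K) (p : ℕ) [Fact p.Prime]
  (κ : ZpExtension K p)

/-- **Greenberg's Lemma 3.2 with `B = 0`, for ANY `ℤ_p`-extension.** For an elliptic curve `E/K`
over a number field, a prime `p` and a `ℤ_p`-extension `K_∞ = ⋃ K_n` with
`B = E(K_∞)[p^∞] = E[p^∞]^{Gal(K̄/K_∞)} = 0`: for every `n`, the restriction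
`h_n : H¹(K_n, E[p^∞]) → H¹(K_∞, E[p^∞])^{Γ_n}` is ONTO the invariants —
`W.layerInvariants κ n ≤ (W.layerToInfty κ n).range`, derived here from
`exists_resOfLe_eq_of_forall_conjH1_eq` (`Γ_K` profinite, `Gal(K̄/K_∞)` compact, `E[p^∞]` discrete
with continuous orbit maps). NOT new capability: the tree's `Greenberg1999_layerInvariants_le_range_holds`
(via `ZpExtension.mem_range_resOfLe_of_conjH1_eq`, `IwasawaSelmerControlCokerProofs.lean`) proves the
same inclusion for every `ℤ_p`-extension WITHOUT the hypothesis `B = 0`. With the reverse inclusion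
`range_layerToInfty_le_layerInvariants_holds` this is `im h_n = H¹(K_∞,E[p^∞])^{Γ_n}`.
[cite: GreenbergLNM1716, §3 Lemma 3.2 (p. 86)] [cite: SerreGaloisCohomology1997, I.§2.6 (b)] -/
theorem layerInvariants_le_range_of_fixedPoints_eq_bot
    (hB : FixedPoints.addSubgroup κ.kerSubgroup (W.geomPrimaryTorsion p) = ⊥) (n : ℕ) :
    W.layerInvariants κ n ≤ (W.layerToInfty κ n).range := by
  intro x hx
  rw [WeierstrassCurve.mem_layerInvariants_iff] at hx
  have hfix : ∀ m : W.geomPrimaryTorsion p,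
      (∀ τ : κ.kerSubgroup, (τ : Field.absoluteGaloisGroup K) • m = m) → m = 0 := by
    intro m hm
    have hm' : m ∈ FixedPoints.addSubgroup κ.kerSubgroup (W.geomPrimaryTorsion p) := fun τ ↦ hm τ
    rw [hB] at hm'
    exact hm'
  obtain ⟨y, hy⟩ := exists_resOfLe_eq_of_forall_conjH1_eq κ.kerSubgroup
    (W.continuous_smul_geomPrimaryTorsion p) hfix (κ.kerSubgroup_le_layerSubgroup n) x hx
  exact ⟨y, hy⟩

/-- `im h_n = H¹(K_∞, E[p^∞])^{Γ_n}` under `B = 0` (both inclusions).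
[cite: GreenbergLNM1716, §3 Lemma 3.2 (p. 86)] -/
theorem range_layerToInfty_eq_layerInvariants_of_fixedPoints_eq_bot
    (hB : FixedPoints.addSubgroup κ.kerSubgroup (W.geomPrimaryTorsion p) = ⊥) (n : ℕ) :
    (W.layerToInfty κ n).range = W.layerInvariants κ n :=
  le_antisymm (W.range_layerToInfty_le_layerInvariants_holds κ n)
    (layerInvariants_le_range_of_fixedPoints_eq_bot W p κ hB n)

end Elliptic

/-! ### X11b's data: `Irr ∧ Ram`, `K` quadratic, any `ℤ_p`-extension -/

section X11b

variable (W : WeierstrassCurve ℚ) [W.IsElliptic] [W.IsGloballyMinimal] (p : ℕ) [Fact p.Prime]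

/-- **On X11b's data `h_n` is ONTO `H¹(K_∞, E[p^∞])^{Γ_n}`** — for `E/ℚ` with `E[p]` irreducible
(`Irr`) and a (ram) prime, `p ≠ 2`, `K` a quadratic field and `κ` ANY `ℤ_p`-extension of `K` (in
particular the anticyclotomic one of routes p2 / R1): `E(K_∞)[p^∞] = 0` (multr1-p1,
`fixedPoints_kerSubgroup_eq_bot_of_irr_of_ram`) + `layerInvariants_le_range_of_fixedPoints_eq_bot`.
Together with the sibling's `resSubgroup_kerSubgroup_injective_of_irr_of_ram` (Lemma 3.1, `B = 0`):
`H¹(K_n, E[p^∞]) ≅ H¹(K_∞, E[p^∞])^{Γ_n}` — the step `coker(h) = 0` of route p2's one-sided control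
input (REPORT §18.5) is a THEOREM on the route's objects (as it already was by the tree's general
Lemma 3.2, `ZpExtension.mem_range_resOfLe_of_conjH1_eq`).
[cite: GreenbergLNM1716, §3 Lemmas 3.1–3.2 (p. 86)] [cite: JetchevSkinnerWan2017, §3.3 (control; shape only)]
[cite: Castella2018Erratum, Lemma 2.1 and Remark p. 2] -/
theorem layerInvariants_le_range_of_irr_of_ram (hp2 : p ≠ 2) (hirr : Irr W p) (hram : Ram W p)
    (K : Type) [Field K] [NumberField K] (hK : Module.finrank ℚ K = 2) (κ : ZpExtension K p)
    (n : ℕ) :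
    (W.baseChange K).layerInvariants κ n ≤ ((W.baseChange K).layerToInfty κ n).range :=
  layerInvariants_le_range_of_fixedPoints_eq_bot (W.baseChange K) p κ
    (fixedPoints_kerSubgroup_eq_bot_of_irr_of_ram W p hp2 hirr hram K hK κ) n

/-- **On route R1's population (`ChainLocus`)**, every quadratic `K`, every `ℤ_p`-extension, every
layer: `h_n` is onto the invariants. [cite: GreenbergLNM1716, §3 Lemma 3.2 (p. 86)]
[cite: Castella2018Erratum, Thm. A′ (p. 1)] -/
theorem ChainLocus.layerInvariants_le_range {W : WeierstrassCurve ℚ} [W.IsElliptic]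
    [W.IsGloballyMinimal] {p : ℕ} [Fact p.Prime] (h : ChainLocus W p)
    (K : Type) [Field K] [NumberField K] (hK : Module.finrank ℚ K = 2) (κ : ZpExtension K p)
    (n : ℕ) :
    (W.baseChange K).layerInvariants κ n ≤ ((W.baseChange K).layerToInfty κ n).range :=
  layerInvariants_le_range_of_fixedPoints_eq_bot (W.baseChange K) p κ
    (h.fixedPoints_kerSubgroup_eq_bot K hK κ) n

end X11b

end Summit.BirchSwinnertonDyer.Rank1Residual.X11b

end
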